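import Mathlib
import Literature.Analysis.FluidPDE.Tao2016AveragedNS.ShiftSetCascadeFlows
import Summits.NavierStokesRegularity.NavierStokesRegularity.Theorems.TaoLadderRungTwoFlatMirrorTableDefs
import Summits.NavierStokesRegularity.NavierStokesRegularity.Theorems.TaoLadderRungTwoFlatMirrorField
import Summits.NavierStokesRegularity.NavierStokesRegularity.Theorems.TaoLadderRungTwoFlatMirrorReversibility
import Summits.NavierStokesRegularity.NavierStokesRegularity.Theorems.TaoLadderRungTwoFlatQuadPolarOn
import Summits.NavierStokesRegularity.NavierStokesRegularity.Theorems.TaoLadderRungTwoFlatPulseDefs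
import HarnessLib

/-!
# Bridging the λ₀ = 1 layer to the certificate vocabulary: a bounded global solution of the homogeneous
  mirror lattice IS an exact `PseudoFlowOnShift` flow from each of its states, and its two neutral
  directions are admissible variational solutions (helper for item stmt-NavierStokesRegularity-22987
  `FlatGapCertificatesV2`, crux K_A♭ of route TaoLadderRungTwoFlat; cell harvest/h2-tao-ladder, p1 g19)

* `abs_quadTermOn_mirror_zero_le` — size of the homogeneous field: `|Q(X)_{i,n}| ≤ (3 + 2|ε| + 2|δ|)·M²` when
  `|X| ≤ M` (from the tree's closed forms `MirrorField.quadTermOn_mirrorTable_carrier/bond`);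
* `IsGlobalSol.continuous`, `IsGlobalSol.contDiff` — a bounded global solution is `C¹` in time at every site;
* `pseudoFlowOnShift_of_isGlobalSol` — **for a bounded exact global solution `Φ` of the λ₀ = 1 mirror lattice,
  every tail `t ↦ Φ(s + t)` is an exact zero-slack `PseudoFlowOnShift shiftSetFlat T 0 (mirrorTable ε ε)` flow
  on `[0, T]` from the state `Φ(s)`** — so a pulse (`MirrorPulse.IsPulse`) feeds the (exist₀)/(step₀) clauses
  of the certificate format directly;
* `isVariationalOn_phase`, `isVariationalOn_scaleDir` — along a bounded global solution the phase direction
  `Φ̇ = Q(Φ)` and the scale direction `Φ + tΦ̇` are bounded variational solutions on every `[0, T]`, i.e.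
  admissible test solutions of (S2) `MirrorPulse.LinearisedHopContraction` (which therefore must quotient them).

HONEST FRAMING: elementary calculus about a MODEL lattice (Tao 2016 §4 vocabulary, `S♭`, `mirrorTable ε ε` at
scale ratio 1); no pulse is constructed, nothing is certified, nothing is a statement about the Navier–Stokes
equations.
-/

noncomputable section

-- the sub-problem namespace repeats the summit name by design (D-0017)
set_option linter.dupNamespace false

namespace Summit.NavierStokesRegularity.NavierStokesRegularity.Theorems

open Set Filter Literature.Analysis.FluidPDE Literature.Analysis.FluidPDE.TaoCascade
open scoped Topology

namespace MirrorPulse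

/-! ### Size of the homogeneous field -/

/-- **Size of the homogeneous mirror field**: if `|X_{j,k}(t)| ≤ M` for all `j, k` then
`|Q(X)_{i,n}(t)| ≤ (3 + 2|ε| + 2|δ|) · M²` (carrier: `v² + |δ|av + v² + |ε|av`; bond: `av + |ε|a² + av + |δ|a²`).
[cite: Tao2016AveragedNS, §4 (4.8); route TaoLadderRungTwoFlat, posited table] -/
theorem abs_quadTermOn_mirror_zero_le (ε δ : ℝ) {X : Fin 2 → ℤ → ℝ → ℝ} {M : ℝ} {t : ℝ}
    (hX : ∀ j k, |X j k t| ≤ M) (i : Fin 2) (n : ℤ) :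
    |quadTermOn shiftSetFlat 0 (mirrorTable ε δ) X i n t| ≤ (3 + 2 * |ε| + 2 * |δ|) * M ^ 2 := by
  have hM : 0 ≤ M := (abs_nonneg _).trans (hX 0 0)
  have hp : ∀ j k j' k', |X j k t * X j' k' t| ≤ M ^ 2 := fun j k j' k' => by
    rw [abs_mul, sq]; exact mul_le_mul (hX j k) (hX j' k') (abs_nonneg _) hM
  have hsq : ∀ j k, |X j k t ^ 2| ≤ M ^ 2 := fun j k => by rw [sq]; exact hp j k j k
  fin_cases i
  · rw [show ((⟨0, by norm_num⟩ : Fin 2)) = 0 from rfl, MirrorField.quadTermOn_mirrorTable_carrier]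
    simp only [add_zero, Real.one_rpow, one_mul]
    have h1 := hsq 1 (n - 1); have h2 := hp 0 n 1 (n - 1); have h3 := hsq 1 n; have h4 := hp 0 n 1 n
    calc |X 1 (n - 1) t ^ 2 + δ * (X 0 n t * X 1 (n - 1) t) - (X 1 n t ^ 2 + ε * (X 0 n t * X 1 n t))|
        ≤ |X 1 (n - 1) t ^ 2 + δ * (X 0 n t * X 1 (n - 1) t)| + |X 1 n t ^ 2 + ε * (X 0 n t * X 1 n t)| :=
          abs_sub _ _
      _ ≤ (|X 1 (n - 1) t ^ 2| + |δ| * |X 0 n t * X 1 (n - 1) t|) +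
            (|X 1 n t ^ 2| + |ε| * |X 0 n t * X 1 n t|) := by
          gcongr
          · exact (abs_add_le _ _).trans (by rw [abs_mul])
          · exact (abs_add_le _ _).trans (by rw [abs_mul])
      _ ≤ (M ^ 2 + |δ| * M ^ 2) + (M ^ 2 + |ε| * M ^ 2) := by gcongr
      _ ≤ (3 + 2 * |ε| + 2 * |δ|) * M ^ 2 := by nlinarith [abs_nonneg ε, abs_nonneg δ, sq_nonneg M]
  · rw [show ((⟨1, by norm_num⟩ : Fin 2)) = 1 from rfl, MirrorField.quadTermOn_mirrorTable_bond]
    simp only [add_zero, Real.one_rpow, one_mul]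
    have h1 := hp 0 n 1 n; have h2 := hsq 0 n; have h3 := hp 0 (n + 1) 1 n; have h4 := hsq 0 (n + 1)
    calc |X 0 n t * X 1 n t + ε * X 0 n t ^ 2 - X 0 (n + 1) t * X 1 n t - δ * X 0 (n + 1) t ^ 2|
        ≤ |X 0 n t * X 1 n t| + |ε * X 0 n t ^ 2| + |X 0 (n + 1) t * X 1 n t| + |δ * X 0 (n + 1) t ^ 2| := by
          have e : X 0 n t * X 1 n t + ε * X 0 n t ^ 2 - X 0 (n + 1) t * X 1 n t - δ * X 0 (n + 1) t ^ 2 =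
              X 0 n t * X 1 n t + ε * X 0 n t ^ 2 + (-(X 0 (n + 1) t * X 1 n t)) + (-(δ * X 0 (n + 1) t ^ 2)) := by
            ring
          rw [e]
          refine (abs_add_le _ _).trans ?_
          rw [abs_neg]
          refine add_le_add ((abs_add_le _ _).trans (add_le_add ((abs_add_le _ _)) le_rfl)) le_rfl |>.trans ?_
          rw [abs_neg]
      _ ≤ M ^ 2 + |ε| * M ^ 2 + M ^ 2 + |δ| * M ^ 2 := by
          rw [abs_mul ε, abs_mul δ]; gcongr
      _ ≤ (3 + 2 * |ε| + 2 * |δ|) * M ^ 2 := by nlinarith [abs_nonneg ε, abs_nonneg δ, sq_nonneg M]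

/-! ### Regularity of global solutions -/

/-- Every site of a global solution is continuous in time. [cite: Tao2016AveragedNS, §4 (4.8)] -/
theorem IsGlobalSol.continuous {ε : ℝ} {Φ : Fin 2 → ℤ → ℝ → ℝ} (hΦ : IsGlobalSol ε Φ) (i : Fin 2) (n : ℤ) :
    Continuous (Φ i n) :=
  continuous_iff_continuousAt.2 fun t => (hΦ i n t).continuousAt

/-- The field along a global solution is continuous in time. [cite: Tao2016AveragedNS, §4 (4.8)] -/
theorem IsGlobalSol.continuous_quadTermOn {ε : ℝ} {Φ : Fin 2 → ℤ → ℝ → ℝ} (hΦ : IsGlobalSol ε Φ)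
    (i : Fin 2) (n : ℤ) : Continuous fun t => quadTermOn shiftSetFlat 0 (mirrorTable ε ε) Φ i n t := by
  unfold quadTermOn
  refine continuous_finsetSum _ fun i₁ _ => continuous_finsetSum _ fun i₂ _ =>
    continuous_finsetSum _ fun μ _ => ?_
  exact continuous_const.mul ((hΦ.continuous _ _).mul (hΦ.continuous _ _))

/-- Every site of a global solution is `C¹` in time. [cite: Tao2016AveragedNS, §4 (4.8)] -/
theorem IsGlobalSol.contDiff {ε : ℝ} {Φ : Fin 2 → ℤ → ℝ → ℝ} (hΦ : IsGlobalSol ε Φ) (i : Fin 2) (n : ℤ) :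
    ContDiff ℝ 1 (Φ i n) := by
  rw [contDiff_one_iff_deriv]
  refine ⟨fun t => (hΦ i n t).differentiableAt, ?_⟩
  have e : deriv (Φ i n) = fun t => quadTermOn shiftSetFlat 0 (mirrorTable ε ε) Φ i n t :=
    funext fun t => (hΦ i n t).deriv
  rw [e]
  exact hΦ.continuous_quadTermOn i n

/-! ### Global solutions are exact flows of the certificate format -/

/-- **A bounded exact global solution of the λ₀ = 1 mirror lattice is, from each of its states, an exact
zero-slack `PseudoFlowOnShift` flow** on every clock window `[0, T]`, `T > 0`: `t ↦ Φ(s+t)` with energies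
`½Φ(s+t)²`. [cite: Tao2016AveragedNS, §4 Lemma 4.1 (4.5), (4.8)–(4.10) (displays); route TaoLadderRungTwoFlat, λ₀ = 1 layer] -/
theorem pseudoFlowOnShift_of_isGlobalSol {ε : ℝ} {Φ : Fin 2 → ℤ → ℝ → ℝ} (hΦ : IsGlobalSol ε Φ)
    (hb : IsBddFam Φ) {T : ℝ} (hT : 0 < T) (s : ℝ) :
    PseudoFlowOnShift shiftSetFlat T 0 (mirrorTable ε ε) 0 0 (fun i k => Φ i k s)
      (fun i k => (1 / 2) * Φ i k s ^ 2) (fun _ _ => 0) (fun i k t => Φ i k (s + t))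
      (fun i k t => (1 / 2) * Φ i k (s + t) ^ 2) := by
  obtain ⟨M, hM⟩ := hb
  have hcd : ∀ i k, ContDiffOn ℝ 1 (fun t => Φ i k (s + t)) (Icc 0 T) := fun i k =>
    ((hΦ.contDiff i k).comp (contDiff_const.add contDiff_id)).contDiffOn
  have hderiv : ∀ i k t, HasDerivAt (fun u => Φ i k (s + u))
      (quadTermOn shiftSetFlat 0 (mirrorTable ε ε) (fun j l u => Φ j l (s + u)) i k t) t := by
    intro i k t
    have hg : HasDerivAt (fun u : ℝ => s + u) 1 t := by simpa using (hasDerivAt_id t).const_add s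
    have h1 := (hΦ i k (s + t)).comp t hg
    rw [mul_one] at h1
    rw [MirrorReversibility.quadTermOn_comp_time shiftSetFlat 0 (mirrorTable ε ε) Φ (fun u => s + u) i k t]
    exact h1
  have hder : ∀ i k t, t ∈ Icc 0 T → derivWithin (fun u => Φ i k (s + u)) (Icc 0 T) t =
      quadTermOn shiftSetFlat 0 (mirrorTable ε ε) (fun j l u => Φ j l (s + u)) i k t := fun i k t ht =>
    (hderiv i k t).hasDerivWithinAt.derivWithin (uniqueDiffOn_Icc hT t ht)
  refine
    { contDiffOn_S := hcd
      contDiffOn_F := fun i k => contDiffOn_const.mul ((hcd i k).pow 2)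
      nonneg_F := fun i k u _ => by positivity
      apriori_S := ⟨2 * M, fun u _ i k => ?_⟩
      apriori_F := ⟨2 * M, fun u _ i k => ?_⟩
      init_S := fun i k => by simp
      init_F := fun i k => by simp
      motion := fun i k u hu => by rw [hder i k u hu, sub_self, abs_zero, zero_mul, zero_mul]
      energy := fun i k u hu => ?_
      defect_lower := fun i k u hu => le_rfl
      defect_upper := fun i k u hu => by simp }
  · have : (1 + (1 + (0 : ℝ)) ^ ((10 : ℝ) * k)) = 2 := by norm_num
    rw [this]
    linarith [hM i k (s + u)]
  · have h2 : (1 + (1 + (0 : ℝ)) ^ ((10 : ℝ) * k)) = 2 := by norm_num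
    have hx : Real.sqrt ((1 / 2) * Φ i k (s + u) ^ 2) ≤ |Φ i k (s + u)| := by
      rw [show |Φ i k (s + u)| = Real.sqrt (Φ i k (s + u) ^ 2) from (Real.sqrt_sq_eq_abs _).symm]
      exact Real.sqrt_le_sqrt (by nlinarith [sq_nonneg (Φ i k (s + u))])
    rw [h2]
    linarith [hM i k (s + u)]
  · have h2 : HasDerivWithinAt (fun t => (1 / 2 : ℝ) * Φ i k (s + t) ^ 2)
        ((1 / 2 : ℝ) * (((2 : ℕ) : ℝ) * Φ i k (s + u) ^ (2 - 1) *
          quadTermOn shiftSetFlat 0 (mirrorTable ε ε) (fun j l u => Φ j l (s + u)) i k u)) (Icc 0 T) u :=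
      ((hderiv i k u).hasDerivWithinAt.pow 2).const_mul (1 / 2 : ℝ)
    show derivWithin (fun t => (1 / 2 : ℝ) * Φ i k (s + t) ^ 2) (Icc 0 T) u ≤
      quadTermOn shiftSetFlat 0 (mirrorTable ε ε) (fun j l u => Φ j l (s + u)) i k u * Φ i k (s + u)
    rw [h2.derivWithin (uniqueDiffOn_Icc hT u hu)]
    norm_num
    apply le_of_eq
    ring

/-- In particular a PULSE is, from each of its states, an exact flow of the format on every clock window.
[cite: Tao2016AveragedNS, §4 Lemma 4.1 (displays); route TaoLadderRungTwoFlat, λ₀ = 1 layer] -/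
theorem IsPulse.pseudoFlowOnShift {ε τ : ℝ} {Φ : Fin 2 → ℤ → ℝ → ℝ} (hΦ : IsPulse ε τ Φ) {T : ℝ}
    (hT : 0 < T) (s : ℝ) :
    PseudoFlowOnShift shiftSetFlat T 0 (mirrorTable ε ε) 0 0 (fun i k => Φ i k s)
      (fun i k => (1 / 2) * Φ i k s ^ 2) (fun _ _ => 0) (fun i k t => Φ i k (s + t))
      (fun i k t => (1 / 2) * Φ i k (s + t) ^ 2) :=
  pseudoFlowOnShift_of_isGlobalSol hΦ.2.1 hΦ.2.2.2.1 hT s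

/-! ### The neutral directions are admissible test solutions of (S2) -/

/-- Along a bounded global solution, the PHASE direction `Φ̇ = Q(Φ)` is a bounded variational solution on every
`[0, T]`. [cite: Tao2016AveragedNS, §4 (4.8); route TaoLadderRungTwoFlat, λ₀ = 1 layer (S2)] -/
theorem isVariationalOn_phase {ε : ℝ} {Φ : Fin 2 → ℤ → ℝ → ℝ} (hΦ : IsGlobalSol ε Φ) (hb : IsBddFam Φ)
    (T : ℝ) :
    IsVariationalOn ε T Φ (fun i n t => quadTermOn shiftSetFlat 0 (mirrorTable ε ε) Φ i n t) := by
  obtain ⟨M, hM⟩ := hb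
  refine ⟨fun i n t => hasDerivAt_phase hΦ i n t, (3 + 2 * |ε| + 2 * |ε|) * M ^ 2, fun i n t _ => ?_⟩
  exact abs_quadTermOn_mirror_zero_le ε ε (fun j k => hM j k t) i n

/-- Along a bounded global solution, the SCALE direction `Φ + tΦ̇` is a bounded variational solution on every
`[0, T]`, `T ≥ 0`. [cite: Tao2016AveragedNS, §4 (4.8); route TaoLadderRungTwoFlat, λ₀ = 1 layer (S2)] -/
theorem isVariationalOn_scaleDir {ε : ℝ} {Φ : Fin 2 → ℤ → ℝ → ℝ} (hΦ : IsGlobalSol ε Φ) (hb : IsBddFam Φ)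
    {T : ℝ} (hT : 0 ≤ T) :
    IsVariationalOn ε T Φ
      (fun i n t => Φ i n t + t * quadTermOn shiftSetFlat 0 (mirrorTable ε ε) Φ i n t) := by
  obtain ⟨M, hM⟩ := hb
  have hM0 : 0 ≤ M := (abs_nonneg _).trans (hM 0 0 0)
  refine ⟨fun i n t => hasDerivAt_scale hΦ i n t, M + T * ((3 + 2 * |ε| + 2 * |ε|) * M ^ 2),
    fun i n t ht => ?_⟩
  have hq := abs_quadTermOn_mirror_zero_le ε ε (fun j k => hM j k t) i n
  have hK : 0 ≤ (3 + 2 * |ε| + 2 * |ε|) * M ^ 2 := by positivity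
  calc |Φ i n t + t * quadTermOn shiftSetFlat 0 (mirrorTable ε ε) Φ i n t|
      ≤ |Φ i n t| + |t * quadTermOn shiftSetFlat 0 (mirrorTable ε ε) Φ i n t| := abs_add_le _ _
    _ = |Φ i n t| + t * |quadTermOn shiftSetFlat 0 (mirrorTable ε ε) Φ i n t| := by
        rw [abs_mul, abs_of_nonneg ht.1]
    _ ≤ M + T * ((3 + 2 * |ε| + 2 * |ε|) * M ^ 2) :=
        add_le_add (hM i n t) (mul_le_mul ht.2 hq (abs_nonneg _) hT)

end MirrorPulse

end Summit.NavierStokesRegularity.NavierStokesRegularity.Theorems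

end
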